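import Summits.QuantumFields.BalabanUV.Beta.FP.KKTSecondVariation

/-!
# `BalabanUV.Beta.FP.NestedStepLawMovingBorder` — road «FP» for binder row D1, RULING R-FP-48 row **FACTOR** at MODEL level (owner, gen 16):
# THE SECOND VARIATION OF THE NESTED STEP LAW WITH **MOVING BORDERS AND A MOVING BLOCK TERM** — for `C²` curves of fine form `H(u)`, one-step
# constraint `Q(u)`, block term `G(u)` and coarse constraint `P(u)`, the one-loop functional `secondVar` (= `2·(½·tadpole − ½·bubble)`) of the COMPOSITE
# bordered system `kkt (H + QᵀGQ) (P·Q)` IS the one of the FINE system `kkt H Q` PLUS the one of the BLOCK system `kkt (effForm H Q + G) P`, EACH WITH ITS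
# OWN BORDERED JETS; and the same identity in the six-loop words of `KKTSecondVariation.sixLoops_kkt` (every word with its own `flucCov ∕ minOp ∕ effForm`)

HONEST DEPENDENCY (page 1, mandatory): continuum YM on T⁴ ⇐ BetaPertH ∧ nine spine estimates (0/9 proved); BetaPertH ⇐ (D1) ∧ (D4) ∧ CAP+tail;
G-an2-4 gates asym, D1 and NE2/3/4.  HONEST FRAMING (cell contract, verbatim): «discharging `BetaPertH` makes Bałaban's UV stability UNCONDITIONAL —
a real constructive-QFT result; it is NOT the continuum limit and NOT the Clay problem.»  THIS MODULE DISCHARGES NOTHING of the wall: it is [folklore]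
finite-dimensional linear algebra ∕ one-variable calculus composed BY NAME from `CompositionSingular.abs_det_kkt_compForm_of_kkt` ∕
`det_kkt_compForm_ne_zero_iff` (the Fubini law of bordered determinants with a block term pulled back, `IsUnit`-free form), road BF-x's
`D1BFx.LogDetSecondVariation.secondVar_comb_eq_zero` (Jacobi twice + uniqueness of derivatives), `D1BFx.SliceTransferModel.hasDerivAt_kkt` ∕ `hasDerivAt_matMul` ∕
`hasDerivAt_transpose_mul` and `FP.KKTSecondVariation.sixLoops_kkt` (the six loops of a bordered curve with MOVING border).  No `def`, no `def … : Prop`,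
nothing cited, 0 sorry; 0∕4 row-D1 binders; NOT SDF for the literal's perfect objects (that is the KERNEL-level road instance: rows SLOT′ ∕ FACTOR ∕ TRANSPORT′ ∕
UNLIFT′ ∕ TAD ∕ KILL of RULING R-FP-48, journal [D1P3-G16-RFP48]), NOT D1, NOT BetaPertH, NOT continuum, NOT Clay.  «not in print; our bookkeeping».

ABSOLUTE RULE (cell charter, verbatim): «No internally-minted statement may enter as a cited fact. Every hypothesis is either kernel-proved in this package or a
verbatim quotation of a PUBLISHED theorem with page reference. The manuscript(s) under audit are NOT citable for their own disputed steps — they are the thing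
under adjudication; programme-internal (2001/route/tribunal) claims are never citable.»

WHY (RULING R-FP-48, answering leaf-02's Q-d1leaf02g15-2).  The owner's gen-15 oracle `NestedDressingHessian.secondVar_nestedStepLaw` is the STATIC-border case:
all constraints fixed, the background enters through the fine form only, so the composite's `G₁`-words and `G_c`-words (`FFPerturbationHessWords.hessKer_add_kernel_words`)
coincide with the fine and the block factor.  For the literal the averaging DEPENDS on the background: along the composite minimiser curve the one-step border
`Q(u) = DQ₁(U(u))`, the coarse border `P(u) = DQ^{(m)}↑(ψ(u))` and the multiplier terms move, and the composite field block is
`A″(U) − φ·Hess Q^{(m+1)}(U) = [A″(U) − φ₁·Hess Q₁(U)] − DQ₁ᵀ·(φ·Hess Q^{(m)}↑)·DQ₁` (second-order chain rule for `Q^{(m+1)} = Q^{(m)}↑ ∘ Q₁`, `φ₁ := DQ^{(m)↑ᵀ}φ`;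
leaf-02's `CompositeAveragingTablesInf.HComp_succ_succ`: the transported family and the LIFTED family), i.e. `compForm H Q G` with `H := A″ − φ₁·HessQ₁` and
`G := −φ·HessQ^{(m)}↑`.  The determinant FACTORISES POINTWISE — `|det kkt (compForm H Q G) (P·Q)| = |det kkt H Q| · |det kkt (effForm H Q + G) P|`
(`abs_det_kkt_compForm_of_kkt`; the block term is invisible to the fine factor and shifts the effective form, `effForm_add_conj`) — hence along ANY `C²` curve of
the four data the three `secondVar`s satisfy composite = fine + block, each system differentiated with ITS OWN bordered jets.  This is the organising identity of
(SDF) under R-FP-45 ∕ R-FP-46 (B′) with borders: the fine factor along the composite minimiser is the ONE-STEP system along the coarse minimiser `ψ(u)`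
((J-S) + multiplier transport), whose second variation is `(F₁∘ψ)″ = F₁″[ψ̇,ψ̇] + F₁′[ψ̈]` = transport `RP m` + the `T₁`-linear `CROSS m` (row TRANSPORT′, E-FP-15-1);
the block factor is the m-fold system of the tree-level EFFECTIVE action (`effForm H Q = A₁″(ψ)`, block term `G`, border `P`) = `TP m` at the fixed point (row UNLIFT′).

CONTENTS ([folklore]; `ν` fine, `μ` intermediate (one-step block), `κ` coarse indices):
* §1 `det_kkt_comp_ne_zero` — the composite bordered determinant is non-zero as soon as the fine and the block ones are; `log_abs_det_kkt_comp_factor` — the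
  pointwise factorisation `|det kkt (compForm H Q G) (P·Q)| = |det kkt H Q|·|det kkt (effForm H Q + G) P|` (`abs_det_kkt_compForm_of_kkt`, BY NAME) in `log` form.
* §2 **`secondVar_nestedStepLaw_movingBorder`** — THE SECOND VARIATION OF THE NESTED STEP LAW WITH MOVING BORDERS: composite, fine and block bordered curves
  displayed as ANY `C²` curves `(𝔎, 𝔔)`, `(H, Q)`, `(E, P)` that COINCIDE near `0` with `(compForm H Q G, P·Q)` resp. `effForm H Q + G` (pattern of
  `HorizontalModel.secondVar_threeSystems` ∕ the gen-15 oracle's `hEeq`; the jets of the composite in terms of those of `H, Q, G, P` are Leibniz — §4); fine and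
  block systems non-degenerate at `0`.  CONCLUSION: `secondVar 𝕂_comp = secondVar 𝕂_fine + secondVar 𝕂_block` at `u = 0`, every system with its own `(K̇, Q̇; K̈, Q̈)`.
* §3 **`sixLoops_nestedStepLaw_movingBorder`** — the same in the `½·tadpole − ½·bubble` words of `KKTSecondVariation.sixLoops_kkt` (`Γ = flucCov`, `𝓘 = minOp`,
  `𝔊 = effForm` OF EACH SYSTEM): the MODEL of `TP (m+1) = [RP m + CROSS m] + TP m` with the border words `2tr(ΓK̇𝓘Q̇) + tr(𝓘Q̇𝓘Q̇) − tr(𝔊·Q̇ΓQ̇ᵀ) − tr(𝓘Q̈)`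
  present in all three systems — which words the rows TRANSPORT′ ∕ UNLIFT′ must carry, by name.
* §4 `hasDerivAt_mul_curves` ∕ `hasDerivAt_compForm_curves` — Leibniz for `u ↦ P(u)·Q(u)` and `u ↦ compForm (H u) (Q u) (G u)` (first jets), so that an
  instantiator can take `𝔔 := P·Q`, `𝔎 := compForm H Q G` LITERALLY and read their jets.
* §5 (v1.1, append-only; leaf-06 XREAD C-d1leaf06g15-3 INFO-1) `hasDerivAt_sandwich_curves` (`(XᵀYZ)˙`), `hasDerivAt_mul_curves_jet` ∕ `hasDerivAt_compForm_curves_jet` (the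
  SECOND jets of `P·Q` and of `compForm H Q G` — nine words of the lifted block term), **`secondVar_nestedStepLaw_movingBorder_explicit`** (§2 with the composite system
  LITERALLY `(compForm H Q G, P·Q)` and its jets written out; no free composite jets for the consumer).
Provenance: road FP OWNER b2b-balaban-beta-d1-p3 gen 16 (prover-b2b-balaban-beta-d1-p3-g16-0), 2026-08-21; RULING R-FP-48 row FACTOR (model); successor of
`FP/NestedDressingHessian` (static border).  Orientation only (nothing quoted is load-bearing): the composition of renormalization transformations with their
averaging constraints is the subject of [Balaban1987RG1] §1 (1.1)–(1.22) pp. 255–264; this file's content is textbook calculus of `log|det|`.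
-/

noncomputable section

namespace Summit.QuantumFields.BalabanUV.Beta.FP.NestedStepLawMovingBorder

open Matrix Filter Finset
open scoped Topology
open Literature.MathematicalPhysics.QuantumFieldTheory.Balaban1983to89.Beta.Composition (kkt compForm)
open Literature.MathematicalPhysics.QuantumFieldTheory.Balaban1983to89.Beta.CompositionSingular (effForm flucCov minOp
  abs_det_kkt_compForm_of_kkt det_kkt_compForm_ne_zero_iff)
open Literature.Analysis.Calculus (eventually_det_ne_zero)
open Summit.QuantumFields.BalabanUV.Beta.D1BFx.LogDetSecondVariation (secondVar secondVar_comb_eq_zero)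
open Summit.QuantumFields.BalabanUV.Beta.D1BFx.SliceTransferModel (hasDerivAt_kkt hasDerivAt_matMul hasDerivAt_transpose_mul hasDerivAt_entry)
open Summit.QuantumFields.BalabanUV.Beta.FP.KKTSecondVariation (sixLoops_kkt)

/-! ## §1 The pointwise factorisation of the composite bordered determinant -/

section Factor

variable {ν μ κ : Type*} [Fintype ν] [Fintype μ] [Fintype κ] [DecidableEq ν] [DecidableEq μ] [DecidableEq κ]

/-- [folklore] **THE COMPOSITE BORDERED DETERMINANT IS NON-ZERO** as soon as the fine one and the block one are. -/
theorem det_kkt_comp_ne_zero (H : Matrix ν ν ℝ) (Q : Matrix μ ν ℝ) (G : Matrix μ μ ℝ) (P : Matrix κ μ ℝ) (h1 : (kkt H Q).det ≠ 0)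
    (h2 : (kkt (effForm H Q + G) P).det ≠ 0) : (kkt (compForm H Q G) (P * Q)).det ≠ 0 :=
  (det_kkt_compForm_ne_zero_iff H Q G P (isUnit_iff_ne_zero.mpr h1)).mpr h2

/-- [folklore] **THE NESTED STEP LAW AT DETERMINANT LEVEL, `log` form**: under the two non-degeneracies,
`log|det kkt (compForm H Q G) (P·Q)| = log|det kkt H Q| + log|det kkt (effForm H Q + G) P|` — NO constant, for EVERY `(H, Q, G, P)`. -/
theorem log_abs_det_kkt_comp_factor (H : Matrix ν ν ℝ) (Q : Matrix μ ν ℝ) (G : Matrix μ μ ℝ) (P : Matrix κ μ ℝ) (h1 : (kkt H Q).det ≠ 0)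
    (h2 : (kkt (effForm H Q + G) P).det ≠ 0) :
    Real.log |(kkt (compForm H Q G) (P * Q)).det| = Real.log |(kkt H Q).det| + Real.log |(kkt (effForm H Q + G) P).det| := by
  rw [abs_det_kkt_compForm_of_kkt H Q G P h1, Real.log_mul (abs_ne_zero.mpr h1) (abs_ne_zero.mpr h2)]

end Factor

/-! ## §2 The second variation of the nested step law with moving borders -/

section SecondVar

variable {ν μ κ : Type*} [Fintype ν] [Fintype μ] [Fintype κ] [DecidableEq ν] [DecidableEq μ] [DecidableEq κ]

/-- [folklore] **THE SECOND VARIATION OF THE NESTED STEP LAW WITH MOVING BORDERS AND A MOVING BLOCK TERM** (row FACTOR of RULING R-FP-48 at MODEL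
level).  Data: `C²` curves (first-jet curve near `0`, second jet at `0`) of the FINE system `u ↦ (H u, Q u)` (fine form, one-step constraint), of the BLOCK
system `u ↦ (E u, P u)` (block form, coarse constraint) and of the COMPOSITE system `u ↦ (𝔎 u, 𝔔 u)`, and a block-term curve `u ↦ G u`, such that NEAR `0`
`𝔎 u = compForm (H u) (Q u) (G u) = H + QᵀGQ`, `𝔔 u = P u · Q u` and `E u = effForm (H u) (Q u) + G u`; the fine and the block bordered matrices
non-degenerate at `0`.  CONCLUSION at `u = 0`:
`secondVar (kkt 𝔎 𝔔) (kkt 𝔎̇ 𝔔̇) (kkt 𝔎̈ 𝔔̈) = secondVar (kkt H Q) (kkt Ḣ Q̇) (kkt Ḧ Q̈) + secondVar (kkt E P) (kkt Ė Ṗ) (kkt Ë P̈)`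
— the one-loop functional of the composite system IS the fine one PLUS the block one, EACH WITH ITS OWN BORDERED JETS; no step defect for any jet, borders
moving or not.  Proof: §1's `log` identity holds near `0` with constant `0` (non-degeneracy persists), then `secondVar_comb_eq_zero` with coefficients `1, −1, −1, 0`. -/
theorem secondVar_nestedStepLaw_movingBorder
    -- the fine system and its jets
    {H H₁ : ℝ → ν → ν → ℝ} {H₂ : Matrix ν ν ℝ} {Q Q₁ : ℝ → μ → ν → ℝ} {Q₂ : Matrix μ ν ℝ}
    (hH : ∀ᶠ u in 𝓝 (0 : ℝ), HasDerivAt H (H₁ u) u) (hH₁ : HasDerivAt H₁ (Matrix.of.symm H₂) 0)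
    (hQ : ∀ᶠ u in 𝓝 (0 : ℝ), HasDerivAt Q (Q₁ u) u) (hQ₁ : HasDerivAt Q₁ (Matrix.of.symm Q₂) 0)
    -- the block system and its jets
    {E E₁ : ℝ → μ → μ → ℝ} {E₂ : Matrix μ μ ℝ} {P P₁ : ℝ → κ → μ → ℝ} {P₂ : Matrix κ μ ℝ}
    (hE : ∀ᶠ u in 𝓝 (0 : ℝ), HasDerivAt E (E₁ u) u) (hE₁ : HasDerivAt E₁ (Matrix.of.symm E₂) 0)
    (hP : ∀ᶠ u in 𝓝 (0 : ℝ), HasDerivAt P (P₁ u) u) (hP₁ : HasDerivAt P₁ (Matrix.of.symm P₂) 0)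
    -- the composite system and its jets
    {𝔎 𝔎₁ : ℝ → ν → ν → ℝ} {𝔎₂ : Matrix ν ν ℝ} {𝔔 𝔔₁ : ℝ → κ → ν → ℝ} {𝔔₂ : Matrix κ ν ℝ}
    (h𝔎 : ∀ᶠ u in 𝓝 (0 : ℝ), HasDerivAt 𝔎 (𝔎₁ u) u) (h𝔎₁ : HasDerivAt 𝔎₁ (Matrix.of.symm 𝔎₂) 0)
    (h𝔔 : ∀ᶠ u in 𝓝 (0 : ℝ), HasDerivAt 𝔔 (𝔔₁ u) u) (h𝔔₁ : HasDerivAt 𝔔₁ (Matrix.of.symm 𝔔₂) 0)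
    -- the block term and the three coincidences near `0`
    {G : ℝ → μ → μ → ℝ}
    (h𝔎eq : ∀ᶠ u in 𝓝 (0 : ℝ), Matrix.of (𝔎 u) = compForm (Matrix.of (H u)) (Matrix.of (Q u)) (Matrix.of (G u)))
    (h𝔔eq : ∀ᶠ u in 𝓝 (0 : ℝ), Matrix.of (𝔔 u) = Matrix.of (P u) * Matrix.of (Q u))
    (hEeq : ∀ᶠ u in 𝓝 (0 : ℝ), Matrix.of (E u) = effForm (Matrix.of (H u)) (Matrix.of (Q u)) + Matrix.of (G u))
    -- non-degeneracy of the fine and of the block system at `0`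
    (h1 : (kkt (Matrix.of (H 0)) (Matrix.of (Q 0))).det ≠ 0) (h2 : (kkt (Matrix.of (E 0)) (Matrix.of (P 0))).det ≠ 0) :
    secondVar (kkt (Matrix.of (𝔎 0)) (Matrix.of (𝔔 0))) (kkt (Matrix.of (𝔎₁ 0)) (Matrix.of (𝔔₁ 0))) (kkt 𝔎₂ 𝔔₂)
      = secondVar (kkt (Matrix.of (H 0)) (Matrix.of (Q 0))) (kkt (Matrix.of (H₁ 0)) (Matrix.of (Q₁ 0))) (kkt H₂ Q₂)
        + secondVar (kkt (Matrix.of (E 0)) (Matrix.of (P 0))) (kkt (Matrix.of (E₁ 0)) (Matrix.of (P₁ 0))) (kkt E₂ P₂) := by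
  -- the first jets, read as matrices
  have hH' : ∀ᶠ u in 𝓝 (0 : ℝ), HasDerivAt H (Matrix.of.symm (Matrix.of (H₁ u))) u := hH
  have hQ' : ∀ᶠ u in 𝓝 (0 : ℝ), HasDerivAt Q (Matrix.of.symm (Matrix.of (Q₁ u))) u := hQ
  have hE' : ∀ᶠ u in 𝓝 (0 : ℝ), HasDerivAt E (Matrix.of.symm (Matrix.of (E₁ u))) u := hE
  have hP' : ∀ᶠ u in 𝓝 (0 : ℝ), HasDerivAt P (Matrix.of.symm (Matrix.of (P₁ u))) u := hP
  have h𝔎' : ∀ᶠ u in 𝓝 (0 : ℝ), HasDerivAt 𝔎 (Matrix.of.symm (Matrix.of (𝔎₁ u))) u := h𝔎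
  have h𝔔' : ∀ᶠ u in 𝓝 (0 : ℝ), HasDerivAt 𝔔 (Matrix.of.symm (Matrix.of (𝔔₁ u))) u := h𝔔
  -- (C) jets of the composite bordered curve
  have hCd : ∀ᶠ u in 𝓝 (0 : ℝ), HasDerivAt (fun u => Matrix.of.symm (kkt (Matrix.of (𝔎 u)) (Matrix.of (𝔔 u))))
      ((fun u => Matrix.of.symm (kkt (Matrix.of (𝔎₁ u)) (Matrix.of (𝔔₁ u)))) u) u := by
    filter_upwards [h𝔎', h𝔔'] with u hu hv
    exact hasDerivAt_kkt hu hv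
  have hC₁d : HasDerivAt (fun u => Matrix.of.symm (kkt (Matrix.of (𝔎₁ u)) (Matrix.of (𝔔₁ u)))) (Matrix.of.symm (kkt 𝔎₂ 𝔔₂)) 0 :=
    hasDerivAt_kkt h𝔎₁ h𝔔₁
  -- (F) jets of the fine bordered curve
  have hFd : ∀ᶠ u in 𝓝 (0 : ℝ), HasDerivAt (fun u => Matrix.of.symm (kkt (Matrix.of (H u)) (Matrix.of (Q u))))
      ((fun u => Matrix.of.symm (kkt (Matrix.of (H₁ u)) (Matrix.of (Q₁ u)))) u) u := by
    filter_upwards [hH', hQ'] with u hu hv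
    exact hasDerivAt_kkt hu hv
  have hF₁d : HasDerivAt (fun u => Matrix.of.symm (kkt (Matrix.of (H₁ u)) (Matrix.of (Q₁ u)))) (Matrix.of.symm (kkt H₂ Q₂)) 0 :=
    hasDerivAt_kkt hH₁ hQ₁
  -- (B) jets of the block bordered curve
  have hBd : ∀ᶠ u in 𝓝 (0 : ℝ), HasDerivAt (fun u => Matrix.of.symm (kkt (Matrix.of (E u)) (Matrix.of (P u))))
      ((fun u => Matrix.of.symm (kkt (Matrix.of (E₁ u)) (Matrix.of (P₁ u)))) u) u := by
    filter_upwards [hE', hP'] with u hu hv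
    exact hasDerivAt_kkt hu hv
  have hB₁d : HasDerivAt (fun u => Matrix.of.symm (kkt (Matrix.of (E₁ u)) (Matrix.of (P₁ u)))) (Matrix.of.symm (kkt E₂ P₂)) 0 :=
    hasDerivAt_kkt hE₁ hP₁
  -- non-degeneracy of the composite system at `0`
  have h𝔎0 : Matrix.of (𝔎 0) = compForm (Matrix.of (H 0)) (Matrix.of (Q 0)) (Matrix.of (G 0)) := h𝔎eq.self_of_nhds
  have h𝔔0 : Matrix.of (𝔔 0) = Matrix.of (P 0) * Matrix.of (Q 0) := h𝔔eq.self_of_nhds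
  have hE0 : Matrix.of (E 0) = effForm (Matrix.of (H 0)) (Matrix.of (Q 0)) + Matrix.of (G 0) := hEeq.self_of_nhds
  have h2' : (kkt (effForm (Matrix.of (H 0)) (Matrix.of (Q 0)) + Matrix.of (G 0)) (Matrix.of (P 0))).det ≠ 0 := by rw [← hE0]; exact h2
  have hC0 : (kkt (Matrix.of (𝔎 0)) (Matrix.of (𝔔 0))).det ≠ 0 := by
    rw [h𝔎0, h𝔔0]; exact det_kkt_comp_ne_zero _ _ _ _ h1 h2'
  -- non-degeneracy persists near `0`, hence the `log|det|` identity holds near `0` with constant `0`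
  have hFne : ∀ᶠ u in 𝓝 (0 : ℝ), (Matrix.of (Matrix.of.symm (kkt (Matrix.of (H u)) (Matrix.of (Q u))))).det ≠ 0 :=
    eventually_det_ne_zero (hFd.self_of_nhds).hasFDerivAt h1
  have hBne : ∀ᶠ u in 𝓝 (0 : ℝ), (Matrix.of (Matrix.of.symm (kkt (Matrix.of (E u)) (Matrix.of (P u))))).det ≠ 0 :=
    eventually_det_ne_zero (hBd.self_of_nhds).hasFDerivAt h2
  have heq : ∀ᶠ u in 𝓝 (0 : ℝ),
      (1 : ℝ) * Real.log |(Matrix.of (Matrix.of.symm (kkt (Matrix.of (𝔎 u)) (Matrix.of (𝔔 u))))).det|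
        + (-1) * Real.log |(Matrix.of (Matrix.of.symm (kkt (Matrix.of (H u)) (Matrix.of (Q u))))).det|
        + (-1) * Real.log |(Matrix.of (Matrix.of.symm (kkt (Matrix.of (E u)) (Matrix.of (P u))))).det|
        + 0 * Real.log |(Matrix.of (Matrix.of.symm (kkt (Matrix.of (E u)) (Matrix.of (P u))))).det| = 0 := by
    filter_upwards [hFne, hBne, h𝔎eq, h𝔔eq, hEeq] with u huF huB hu𝔎 hu𝔔 huE
    have huF' : (kkt (Matrix.of (H u)) (Matrix.of (Q u))).det ≠ 0 := huF
    have huB' : (kkt (Matrix.of (E u)) (Matrix.of (P u))).det ≠ 0 := huB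
    have huB'' : (kkt (effForm (Matrix.of (H u)) (Matrix.of (Q u)) + Matrix.of (G u)) (Matrix.of (P u))).det ≠ 0 := by rw [← huE]; exact huB'
    have hlog := log_abs_det_kkt_comp_factor (Matrix.of (H u)) (Matrix.of (Q u)) (Matrix.of (G u)) (Matrix.of (P u)) huF' huB''
    rw [← huE, ← hu𝔎, ← hu𝔔] at hlog
    show (1 : ℝ) * Real.log |(kkt (Matrix.of (𝔎 u)) (Matrix.of (𝔔 u))).det|
        + (-1) * Real.log |(kkt (Matrix.of (H u)) (Matrix.of (Q u))).det|
        + (-1) * Real.log |(kkt (Matrix.of (E u)) (Matrix.of (P u))).det|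
        + 0 * Real.log |(kkt (Matrix.of (E u)) (Matrix.of (P u))).det| = 0
    rw [hlog]; ring
  -- differentiate twice (`secondVar_comb_eq_zero` with coefficients `1, −1, −1, 0`)
  have h := secondVar_comb_eq_zero (a := 1) (b := -1) (c := -1) (d := 0) (k := 0) (t := 0)
    hCd hC₁d hC0 hFd hF₁d h1 hBd hB₁d h2 hBd hB₁d h2 heq
  simp only [one_mul, neg_one_mul, zero_mul, add_zero] at h
  have h' : secondVar (kkt (Matrix.of (𝔎 0)) (Matrix.of (𝔔 0))) (kkt (Matrix.of (𝔎₁ 0)) (Matrix.of (𝔔₁ 0))) (kkt 𝔎₂ 𝔔₂)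
      - secondVar (kkt (Matrix.of (H 0)) (Matrix.of (Q 0))) (kkt (Matrix.of (H₁ 0)) (Matrix.of (Q₁ 0))) (kkt H₂ Q₂)
      - secondVar (kkt (Matrix.of (E 0)) (Matrix.of (P 0))) (kkt (Matrix.of (E₁ 0)) (Matrix.of (P₁ 0))) (kkt E₂ P₂) = 0 := by
    have : ∀ x y z : ℝ, x + -y + -z = x - y - z := fun x y z => by ring
    rw [← this]; exact h
  linarith

end SecondVar

/-! ## §3 The same identity in the six-loop words of each system -/

section SixLoops

variable {ν μ κ : Type*} [Fintype ν] [Fintype μ] [Fintype κ] [DecidableEq ν] [DecidableEq μ] [DecidableEq κ]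

/-- [folklore] **THE NESTED STEP LAW WITH MOVING BORDERS IN THE `½·tadpole − ½·bubble` WORDS OF EACH SYSTEM** (`KKTSecondVariation.sixLoops_kkt` ×3 on
`secondVar_nestedStepLaw_movingBorder`).  With, FOR EACH SYSTEM SEPARATELY, `Γ = flucCov`, `𝓘 = minOp`, `𝔊 = effForm` of its own bordered matrix at `0` and its
own jets `(K̇, Q̇; K̈, Q̈)` (symmetric forms and symmetric first form-jets), the six loops
`½tr(ΓK̇ΓK̇) − ½tr(ΓK̈) + 2tr(ΓK̇𝓘Q̇) + tr(𝓘Q̇𝓘Q̇) − tr(𝔊·Q̇ΓQ̇ᵀ) − tr(𝓘Q̈)` of the COMPOSITE system equal those of the FINE system PLUS those of the BLOCK system.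
READING for the road (R-FP-48): LHS = `TP (m+1)` (composite resolvent, composite border `P·Q`, composite tables incl. the lifted multiplier family inside `K̇ = 𝔎̇`);
fine six loops = the ONE-STEP system along the coarse minimiser (`RP m + CROSS m`, row TRANSPORT′ — border words `Q̇ = DQ₁`-jets at ALL one-step blocks);
block six loops = the m-fold system of the effective action (`TP m`, row UNLIFT′ — border words `Ṗ`, form jets `Ė = (effForm H Q)˙ + Ġ`, sub-row (J-E′)). -/
theorem sixLoops_nestedStepLaw_movingBorder
    {H H₁ : ℝ → ν → ν → ℝ} {H₂ : Matrix ν ν ℝ} {Q Q₁ : ℝ → μ → ν → ℝ} {Q₂ : Matrix μ ν ℝ}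
    (hH : ∀ᶠ u in 𝓝 (0 : ℝ), HasDerivAt H (H₁ u) u) (hH₁ : HasDerivAt H₁ (Matrix.of.symm H₂) 0)
    (hQ : ∀ᶠ u in 𝓝 (0 : ℝ), HasDerivAt Q (Q₁ u) u) (hQ₁ : HasDerivAt Q₁ (Matrix.of.symm Q₂) 0)
    {E E₁ : ℝ → μ → μ → ℝ} {E₂ : Matrix μ μ ℝ} {P P₁ : ℝ → κ → μ → ℝ} {P₂ : Matrix κ μ ℝ}
    (hE : ∀ᶠ u in 𝓝 (0 : ℝ), HasDerivAt E (E₁ u) u) (hE₁ : HasDerivAt E₁ (Matrix.of.symm E₂) 0)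
    (hP : ∀ᶠ u in 𝓝 (0 : ℝ), HasDerivAt P (P₁ u) u) (hP₁ : HasDerivAt P₁ (Matrix.of.symm P₂) 0)
    {𝔎 𝔎₁ : ℝ → ν → ν → ℝ} {𝔎₂ : Matrix ν ν ℝ} {𝔔 𝔔₁ : ℝ → κ → ν → ℝ} {𝔔₂ : Matrix κ ν ℝ}
    (h𝔎 : ∀ᶠ u in 𝓝 (0 : ℝ), HasDerivAt 𝔎 (𝔎₁ u) u) (h𝔎₁ : HasDerivAt 𝔎₁ (Matrix.of.symm 𝔎₂) 0)
    (h𝔔 : ∀ᶠ u in 𝓝 (0 : ℝ), HasDerivAt 𝔔 (𝔔₁ u) u) (h𝔔₁ : HasDerivAt 𝔔₁ (Matrix.of.symm 𝔔₂) 0)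
    {G : ℝ → μ → μ → ℝ}
    (h𝔎eq : ∀ᶠ u in 𝓝 (0 : ℝ), Matrix.of (𝔎 u) = compForm (Matrix.of (H u)) (Matrix.of (Q u)) (Matrix.of (G u)))
    (h𝔔eq : ∀ᶠ u in 𝓝 (0 : ℝ), Matrix.of (𝔔 u) = Matrix.of (P u) * Matrix.of (Q u))
    (hEeq : ∀ᶠ u in 𝓝 (0 : ℝ), Matrix.of (E u) = effForm (Matrix.of (H u)) (Matrix.of (Q u)) + Matrix.of (G u))
    (h1 : (kkt (Matrix.of (H 0)) (Matrix.of (Q 0))).det ≠ 0) (h2 : (kkt (Matrix.of (E 0)) (Matrix.of (P 0))).det ≠ 0)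
    -- the values and first form-jets at `0`, NAMED, and their symmetry
    {K₀ K₁' : Matrix ν ν ℝ} {C₀ C₁' : Matrix μ ν ℝ} (hK₀ : Matrix.of (H 0) = K₀) (hK₁ : Matrix.of (H₁ 0) = K₁') (hC₀ : Matrix.of (Q 0) = C₀)
    (hC₁ : Matrix.of (Q₁ 0) = C₁') (hK₀s : K₀ᵀ = K₀) (hK₁s : K₁'ᵀ = K₁')
    {F₀ F₁' : Matrix μ μ ℝ} {D₀ D₁' : Matrix κ μ ℝ} (hF₀ : Matrix.of (E 0) = F₀) (hF₁ : Matrix.of (E₁ 0) = F₁') (hD₀ : Matrix.of (P 0) = D₀)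
    (hD₁ : Matrix.of (P₁ 0) = D₁') (hF₀s : F₀ᵀ = F₀) (hF₁s : F₁'ᵀ = F₁')
    {N₀ N₁' : Matrix ν ν ℝ} {B₀ B₁' : Matrix κ ν ℝ} (hN₀ : Matrix.of (𝔎 0) = N₀) (hN₁ : Matrix.of (𝔎₁ 0) = N₁') (hB₀ : Matrix.of (𝔔 0) = B₀)
    (hB₁ : Matrix.of (𝔔₁ 0) = B₁') (hN₀s : N₀ᵀ = N₀) (hN₁s : N₁'ᵀ = N₁') :
    (1 / 2 : ℝ) * (flucCov N₀ B₀ * N₁' * (flucCov N₀ B₀ * N₁')).trace - (1 / 2 : ℝ) * (flucCov N₀ B₀ * 𝔎₂).trace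
        + 2 * (flucCov N₀ B₀ * N₁' * (minOp N₀ B₀ * B₁')).trace + (minOp N₀ B₀ * B₁' * (minOp N₀ B₀ * B₁')).trace
        - (effForm N₀ B₀ * (B₁' * (flucCov N₀ B₀ * B₁'ᵀ))).trace - (minOp N₀ B₀ * 𝔔₂).trace
      = ((1 / 2 : ℝ) * (flucCov K₀ C₀ * K₁' * (flucCov K₀ C₀ * K₁')).trace - (1 / 2 : ℝ) * (flucCov K₀ C₀ * H₂).trace
          + 2 * (flucCov K₀ C₀ * K₁' * (minOp K₀ C₀ * C₁')).trace + (minOp K₀ C₀ * C₁' * (minOp K₀ C₀ * C₁')).trace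
          - (effForm K₀ C₀ * (C₁' * (flucCov K₀ C₀ * C₁'ᵀ))).trace - (minOp K₀ C₀ * Q₂).trace)
        + ((1 / 2 : ℝ) * (flucCov F₀ D₀ * F₁' * (flucCov F₀ D₀ * F₁')).trace - (1 / 2 : ℝ) * (flucCov F₀ D₀ * E₂).trace
          + 2 * (flucCov F₀ D₀ * F₁' * (minOp F₀ D₀ * D₁')).trace + (minOp F₀ D₀ * D₁' * (minOp F₀ D₀ * D₁')).trace
          - (effForm F₀ D₀ * (D₁' * (flucCov F₀ D₀ * D₁'ᵀ))).trace - (minOp F₀ D₀ * P₂).trace) := by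
  have h := secondVar_nestedStepLaw_movingBorder hH hH₁ hQ hQ₁ hE hE₁ hP hP₁ h𝔎 h𝔎₁ h𝔔 h𝔔₁ h𝔎eq h𝔔eq hEeq h1 h2
  rw [hK₀, hK₁, hC₀, hC₁, hF₀, hF₁, hD₀, hD₁, hN₀, hN₁, hB₀, hB₁] at h
  rw [← sixLoops_kkt N₀ N₁' 𝔎₂ B₀ B₁' 𝔔₂ hN₀s hN₁s, ← sixLoops_kkt K₀ K₁' H₂ C₀ C₁' Q₂ hK₀s hK₁s,
    ← sixLoops_kkt F₀ F₁' E₂ D₀ D₁' P₂ hF₀s hF₁s, h]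
  ring

end SixLoops

/-! ## §4 Leibniz plumbing: the first jets of the composite data -/

section Leibniz

variable {ν μ κ : Type*} [Fintype ν] [Fintype μ] [Fintype κ]

omit [Fintype κ] in
/-- [folklore] **THE COMPOSITE BORDER'S FIRST JET**: `(P·Q)˙ = Ṗ·Q + P·Q̇` (`hasDerivAt_matMul`, displayed in this file's letters). -/
theorem hasDerivAt_mul_curves {P : ℝ → κ → μ → ℝ} {Q : ℝ → μ → ν → ℝ} {P' : Matrix κ μ ℝ} {Q' : Matrix μ ν ℝ} {t : ℝ}
    (hP : HasDerivAt P (Matrix.of.symm P') t) (hQ : HasDerivAt Q (Matrix.of.symm Q') t) :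
    HasDerivAt (fun u => Matrix.of.symm (Matrix.of (P u) * Matrix.of (Q u)))
      (Matrix.of.symm (P' * Matrix.of (Q t) + Matrix.of (P t) * Q')) t :=
  hasDerivAt_matMul hP hQ

/-- [folklore] **THE COMPOSITE FORM'S FIRST JET**: `(compForm H Q G)˙ = Ḣ + Q̇ᵀGQ + QᵀĠQ + QᵀGQ̇` — the fine form-jet PLUS the three words of the lifted block
term (for the road: `Ḣ` = one-step field jets incl. the transported multiplier family; `QᵀĠQ` = the LIFTED multiplier family `λ²•liftF`; `Q̇ᵀGQ + QᵀGQ̇` = the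
`liftFH`-words, which vanish at `u = 0` when `G(0) = 0`, i.e. at zero background where the multiplier vanishes). -/
theorem hasDerivAt_compForm_curves {H : ℝ → ν → ν → ℝ} {Q : ℝ → μ → ν → ℝ} {G : ℝ → μ → μ → ℝ}
    {H' : Matrix ν ν ℝ} {Q' : Matrix μ ν ℝ} {G' : Matrix μ μ ℝ} {t : ℝ}
    (hH : HasDerivAt H (Matrix.of.symm H') t) (hQ : HasDerivAt Q (Matrix.of.symm Q') t) (hG : HasDerivAt G (Matrix.of.symm G') t) :
    HasDerivAt (fun u => Matrix.of.symm (compForm (Matrix.of (H u)) (Matrix.of (Q u)) (Matrix.of (G u))))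
      (Matrix.of.symm (H' + (Q'ᵀ * Matrix.of (G t) * Matrix.of (Q t) + (Matrix.of (Q t))ᵀ * G' * Matrix.of (Q t)
        + (Matrix.of (Q t))ᵀ * Matrix.of (G t) * Q'))) t := by
  -- `u ↦ QᵀG`
  have h1 : HasDerivAt (fun u => Matrix.of.symm ((Matrix.of (Q u))ᵀ * Matrix.of (G u)))
      (Matrix.of.symm (Q'ᵀ * Matrix.of (G t) + (Matrix.of (Q t))ᵀ * G')) t := hasDerivAt_transpose_mul hQ hG
  -- `u ↦ (QᵀG)·Q`
  have h2 := hasDerivAt_matMul (X := fun u => Matrix.of.symm ((Matrix.of (Q u))ᵀ * Matrix.of (G u))) (Y := Q) h1 hQ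
  simp only [Equiv.apply_symm_apply] at h2
  -- add the fine form
  have h3 := hH.add h2
  refine HasDerivAt.congr_deriv (h3.congr_of_eventuallyEq (Eventually.of_forall fun u => ?_)) ?_
  · funext i j
    simp only [compForm, Pi.add_apply, Matrix.of_symm_apply, Matrix.add_apply, Matrix.of_apply]
  · funext i j
    simp only [Pi.add_apply, Matrix.of_symm_apply, Matrix.add_apply, Matrix.add_mul]

end Leibniz


/-! ## §5 (v1.1, append-only) The composite jets WRITTEN OUT and §2 with the composite system LITERALLY `(compForm H Q G, P·Q)` (leaf-06 XREAD C-d1leaf06g15-3 INFO-1) -/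

section Explicit

variable {ν μ κ : Type*} [Fintype ν] [Fintype μ] [Fintype κ] [DecidableEq ν] [DecidableEq μ] [DecidableEq κ]

omit [DecidableEq ν] [DecidableEq μ] [DecidableEq κ] in
/-- [folklore] **LEIBNIZ FOR A SANDWICH `Xᵀ·Y·Z`**: `(XᵀYZ)˙ = ẊᵀYZ + XᵀẎZ + XᵀYŻ`. -/
theorem hasDerivAt_sandwich_curves {X : ℝ → μ → ν → ℝ} {Y : ℝ → μ → μ → ℝ} {Z : ℝ → μ → κ → ℝ}
    {X' : Matrix μ ν ℝ} {Y' : Matrix μ μ ℝ} {Z' : Matrix μ κ ℝ} {t : ℝ}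
    (hX : HasDerivAt X (Matrix.of.symm X') t) (hY : HasDerivAt Y (Matrix.of.symm Y') t) (hZ : HasDerivAt Z (Matrix.of.symm Z') t) :
    HasDerivAt (fun u => Matrix.of.symm ((Matrix.of (X u))ᵀ * Matrix.of (Y u) * Matrix.of (Z u)))
      (Matrix.of.symm (X'ᵀ * Matrix.of (Y t) * Matrix.of (Z t) + (Matrix.of (X t))ᵀ * Y' * Matrix.of (Z t)
        + (Matrix.of (X t))ᵀ * Matrix.of (Y t) * Z')) t := by
  have h1 : HasDerivAt (fun u => Matrix.of.symm ((Matrix.of (X u))ᵀ * Matrix.of (Y u)))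
      (Matrix.of.symm (X'ᵀ * Matrix.of (Y t) + (Matrix.of (X t))ᵀ * Y')) t := hasDerivAt_transpose_mul hX hY
  have h2 := hasDerivAt_matMul (X := fun u => Matrix.of.symm ((Matrix.of (X u))ᵀ * Matrix.of (Y u))) (Y := Z) h1 hZ
  simpa only [Equiv.apply_symm_apply, Matrix.add_mul] using h2

omit [DecidableEq ν] [DecidableEq μ] [DecidableEq κ] in
/-- [folklore] **THE SECOND JET OF THE COMPOSITE BORDER**: the first-jet curve `u ↦ P₁(u)·Q(u) + P(u)·Q₁(u)` of `P·Q` has derivative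
`P₂Q + ṖQ̇ + ṖQ̇ + PQ₂` at `t` (`Ṗ = P₁ t`, `Q̇ = Q₁ t`; `P₂`, `Q₂` the derivatives of `P₁`, `Q₁` at `t`). -/
theorem hasDerivAt_mul_curves_jet {P P₁ : ℝ → κ → μ → ℝ} {Q Q₁ : ℝ → μ → ν → ℝ} {P₂ : Matrix κ μ ℝ} {Q₂ : Matrix μ ν ℝ} {t : ℝ}
    (hP : HasDerivAt P (P₁ t) t) (hP₁ : HasDerivAt P₁ (Matrix.of.symm P₂) t) (hQ : HasDerivAt Q (Q₁ t) t) (hQ₁ : HasDerivAt Q₁ (Matrix.of.symm Q₂) t) :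
    HasDerivAt (fun u => Matrix.of.symm (Matrix.of (P₁ u) * Matrix.of (Q u) + Matrix.of (P u) * Matrix.of (Q₁ u)))
      (Matrix.of.symm (P₂ * Matrix.of (Q t) + Matrix.of (P₁ t) * Matrix.of (Q₁ t)
        + (Matrix.of (P₁ t) * Matrix.of (Q₁ t) + Matrix.of (P t) * Q₂))) t := by
  have hP' : HasDerivAt P (Matrix.of.symm (Matrix.of (P₁ t))) t := hP
  have hQ' : HasDerivAt Q (Matrix.of.symm (Matrix.of (Q₁ t))) t := hQ
  have h1 := hasDerivAt_matMul hP₁ hQ'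
  have h2 := hasDerivAt_matMul hP' hQ₁
  exact h1.add h2

omit [Fintype κ] [DecidableEq ν] [DecidableEq μ] [DecidableEq κ] in
/-- [folklore] **THE SECOND JET OF THE COMPOSITE FORM**: the first-jet curve `u ↦ Ḣ + Q̇ᵀGQ + QᵀĠQ + QᵀGQ̇` of `compForm H Q G` has derivative
`H₂ + [Q₂ᵀGQ + Q̇ᵀĠQ + Q̇ᵀGQ̇] + [Q̇ᵀĠQ + QᵀG₂Q + QᵀĠQ̇] + [Q̇ᵀGQ̇ + QᵀĠQ̇ + QᵀGQ₂]` at `t` (nine words; at zero background `G(t) = 0` three survive). -/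
theorem hasDerivAt_compForm_curves_jet {H₁ : ℝ → ν → ν → ℝ} {Q Q₁ : ℝ → μ → ν → ℝ} {G G₁ : ℝ → μ → μ → ℝ}
    {H₂ : Matrix ν ν ℝ} {Q₂ : Matrix μ ν ℝ} {G₂ : Matrix μ μ ℝ} {t : ℝ}
    (hH₁ : HasDerivAt H₁ (Matrix.of.symm H₂) t) (hQ : HasDerivAt Q (Q₁ t) t) (hQ₁ : HasDerivAt Q₁ (Matrix.of.symm Q₂) t)
    (hG : HasDerivAt G (G₁ t) t) (hG₁ : HasDerivAt G₁ (Matrix.of.symm G₂) t) :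
    HasDerivAt (fun u => Matrix.of.symm (Matrix.of (H₁ u) + ((Matrix.of (Q₁ u))ᵀ * Matrix.of (G u) * Matrix.of (Q u)
        + (Matrix.of (Q u))ᵀ * Matrix.of (G₁ u) * Matrix.of (Q u) + (Matrix.of (Q u))ᵀ * Matrix.of (G u) * Matrix.of (Q₁ u))))
      (Matrix.of.symm (H₂ +
        ((Q₂ᵀ * Matrix.of (G t) * Matrix.of (Q t) + (Matrix.of (Q₁ t))ᵀ * Matrix.of (G₁ t) * Matrix.of (Q t)
            + (Matrix.of (Q₁ t))ᵀ * Matrix.of (G t) * Matrix.of (Q₁ t))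
          + ((Matrix.of (Q₁ t))ᵀ * Matrix.of (G₁ t) * Matrix.of (Q t) + (Matrix.of (Q t))ᵀ * G₂ * Matrix.of (Q t)
            + (Matrix.of (Q t))ᵀ * Matrix.of (G₁ t) * Matrix.of (Q₁ t))
          + ((Matrix.of (Q₁ t))ᵀ * Matrix.of (G t) * Matrix.of (Q₁ t) + (Matrix.of (Q t))ᵀ * Matrix.of (G₁ t) * Matrix.of (Q₁ t)
            + (Matrix.of (Q t))ᵀ * Matrix.of (G t) * Q₂)))) t := by
  have hQ' : HasDerivAt Q (Matrix.of.symm (Matrix.of (Q₁ t))) t := hQ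
  have hG' : HasDerivAt G (Matrix.of.symm (Matrix.of (G₁ t))) t := hG
  have h1 := hasDerivAt_sandwich_curves hQ₁ hG' hQ'
  have h2 := hasDerivAt_sandwich_curves hQ' hG₁ hQ'
  have h3 := hasDerivAt_sandwich_curves hQ' hG' hQ₁
  exact hH₁.add ((h1.add h2).add h3)

/-- [folklore] **THE NESTED STEP LAW WITH MOVING BORDERS, COMPOSITE SYSTEM WRITTEN OUT** (§2 with `𝔎 := compForm H Q G`, `𝔔 := P·Q` LITERALLY and their jets by §4–§5's
Leibniz rules; the values and jets at `0` NAMED by `rfl`-hypotheses).  Data: `C²` curves `H, Q, G, P` (first-jet curves near `0`, second jets at `0`), the block curve `E` with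
`E = effForm H Q + G` near `0` and its jets, the two non-degeneracies.  CONCLUSION at `0`, with `K̇ = Ḣ + Q̇ᵀGQ + QᵀĠQ + QᵀGQ̇`, `K̈` = §5's nine-word second jet,
`Ċ = ṖQ + PQ̇`, `C̈ = P̈Q + 2ṖQ̇ + PQ̈`:
`secondVar (kkt (compForm H₀ Q₀ G₀) (P₀Q₀)) (kkt K̇ Ċ) (kkt K̈ C̈) = secondVar (kkt H₀ Q₀) (kkt Ḣ Q̇) (kkt Ḧ Q̈) + secondVar (kkt E₀ P₀) (kkt Ė Ṗ) (kkt Ë P̈)`. -/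
theorem secondVar_nestedStepLaw_movingBorder_explicit
    {H H₁ : ℝ → ν → ν → ℝ} {H₂ : Matrix ν ν ℝ} {Q Q₁ : ℝ → μ → ν → ℝ} {Q₂ : Matrix μ ν ℝ} {G G₁ : ℝ → μ → μ → ℝ} {G₂ : Matrix μ μ ℝ}
    (hH : ∀ᶠ u in 𝓝 (0 : ℝ), HasDerivAt H (H₁ u) u) (hH₁ : HasDerivAt H₁ (Matrix.of.symm H₂) 0)
    (hQ : ∀ᶠ u in 𝓝 (0 : ℝ), HasDerivAt Q (Q₁ u) u) (hQ₁ : HasDerivAt Q₁ (Matrix.of.symm Q₂) 0)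
    (hG : ∀ᶠ u in 𝓝 (0 : ℝ), HasDerivAt G (G₁ u) u) (hG₁ : HasDerivAt G₁ (Matrix.of.symm G₂) 0)
    {E E₁ : ℝ → μ → μ → ℝ} {E₂ : Matrix μ μ ℝ} {P P₁ : ℝ → κ → μ → ℝ} {P₂ : Matrix κ μ ℝ}
    (hE : ∀ᶠ u in 𝓝 (0 : ℝ), HasDerivAt E (E₁ u) u) (hE₁ : HasDerivAt E₁ (Matrix.of.symm E₂) 0)
    (hP : ∀ᶠ u in 𝓝 (0 : ℝ), HasDerivAt P (P₁ u) u) (hP₁ : HasDerivAt P₁ (Matrix.of.symm P₂) 0)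
    (hEeq : ∀ᶠ u in 𝓝 (0 : ℝ), Matrix.of (E u) = effForm (Matrix.of (H u)) (Matrix.of (Q u)) + Matrix.of (G u))
    (h1 : (kkt (Matrix.of (H 0)) (Matrix.of (Q 0))).det ≠ 0) (h2 : (kkt (Matrix.of (E 0)) (Matrix.of (P 0))).det ≠ 0)
    -- the values and first jets at `0`, NAMED
    {H₀ A : Matrix ν ν ℝ} {Q₀ B : Matrix μ ν ℝ} {G₀ D : Matrix μ μ ℝ} {P₀ R : Matrix κ μ ℝ}
    (hH₀ : Matrix.of (H 0) = H₀) (hA : Matrix.of (H₁ 0) = A) (hQ₀ : Matrix.of (Q 0) = Q₀) (hB : Matrix.of (Q₁ 0) = B)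
    (hG₀ : Matrix.of (G 0) = G₀) (hD : Matrix.of (G₁ 0) = D) (hP₀ : Matrix.of (P 0) = P₀) (hR : Matrix.of (P₁ 0) = R) :
    secondVar (kkt (compForm H₀ Q₀ G₀) (P₀ * Q₀))
        (kkt (A + (Bᵀ * G₀ * Q₀ + Q₀ᵀ * D * Q₀ + Q₀ᵀ * G₀ * B)) (R * Q₀ + P₀ * B))
        (kkt (H₂ + ((Q₂ᵀ * G₀ * Q₀ + Bᵀ * D * Q₀ + Bᵀ * G₀ * B) + (Bᵀ * D * Q₀ + Q₀ᵀ * G₂ * Q₀ + Q₀ᵀ * D * B)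
            + (Bᵀ * G₀ * B + Q₀ᵀ * D * B + Q₀ᵀ * G₀ * Q₂)))
          (P₂ * Q₀ + R * B + (R * B + P₀ * Q₂)))
      = secondVar (kkt H₀ Q₀) (kkt A B) (kkt H₂ Q₂)
        + secondVar (kkt (Matrix.of (E 0)) P₀) (kkt (Matrix.of (E₁ 0)) R) (kkt E₂ P₂) := by
  have hH' : ∀ᶠ u in 𝓝 (0 : ℝ), HasDerivAt H (Matrix.of.symm (Matrix.of (H₁ u))) u := hH
  have hQ' : ∀ᶠ u in 𝓝 (0 : ℝ), HasDerivAt Q (Matrix.of.symm (Matrix.of (Q₁ u))) u := hQ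
  have hG' : ∀ᶠ u in 𝓝 (0 : ℝ), HasDerivAt G (Matrix.of.symm (Matrix.of (G₁ u))) u := hG
  have hP' : ∀ᶠ u in 𝓝 (0 : ℝ), HasDerivAt P (Matrix.of.symm (Matrix.of (P₁ u))) u := hP
  have h𝔎 : ∀ᶠ u in 𝓝 (0 : ℝ), HasDerivAt (fun u => Matrix.of.symm (compForm (Matrix.of (H u)) (Matrix.of (Q u)) (Matrix.of (G u))))
      ((fun u => Matrix.of.symm (Matrix.of (H₁ u) + ((Matrix.of (Q₁ u))ᵀ * Matrix.of (G u) * Matrix.of (Q u)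
        + (Matrix.of (Q u))ᵀ * Matrix.of (G₁ u) * Matrix.of (Q u) + (Matrix.of (Q u))ᵀ * Matrix.of (G u) * Matrix.of (Q₁ u)))) u) u := by
    filter_upwards [hH', hQ', hG'] with u huH huQ huG
    exact hasDerivAt_compForm_curves huH huQ huG
  have h𝔎₁ := hasDerivAt_compForm_curves_jet hH₁ hQ.self_of_nhds hQ₁ hG.self_of_nhds hG₁
  have h𝔔 : ∀ᶠ u in 𝓝 (0 : ℝ), HasDerivAt (fun u => Matrix.of.symm (Matrix.of (P u) * Matrix.of (Q u)))
      ((fun u => Matrix.of.symm (Matrix.of (P₁ u) * Matrix.of (Q u) + Matrix.of (P u) * Matrix.of (Q₁ u))) u) u := by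
    filter_upwards [hP', hQ'] with u huP huQ
    exact hasDerivAt_mul_curves huP huQ
  have h𝔔₁ := hasDerivAt_mul_curves_jet hP.self_of_nhds hP₁ hQ.self_of_nhds hQ₁
  have h := secondVar_nestedStepLaw_movingBorder hH hH₁ hQ hQ₁ hE hE₁ hP hP₁
    (𝔎 := fun u => Matrix.of.symm (compForm (Matrix.of (H u)) (Matrix.of (Q u)) (Matrix.of (G u))))
    (𝔔 := fun u => Matrix.of.symm (Matrix.of (P u) * Matrix.of (Q u)))
    h𝔎 h𝔎₁ h𝔔 h𝔔₁ (G := G)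
    (Eventually.of_forall fun u => by simp only [Equiv.apply_symm_apply])
    (Eventually.of_forall fun u => by simp only [Equiv.apply_symm_apply]) hEeq h1 h2
  simp only [Equiv.apply_symm_apply, hH₀, hA, hQ₀, hB, hG₀, hD, hP₀, hR] at h
  exact h

end Explicit

end Summit.QuantumFields.BalabanUV.Beta.FP.NestedStepLawMovingBorder

end
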